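import Literature.MathematicalPhysics.KineticTheory.HardSphereEuler
import Literature.Analysis.FunctionSpaces.TorusCalculus

/-!
# Restriction / gluing / congruence API for classical hard-sphere–Euler solutions

Helper file for the line `log-lipschitz-budget` of the crux
`ImplosionDichotomy.PolynomialCompression` (stubs `stub_conditionalExistence` and
`stub_logBudgetShadowing`): the elementary structural lemmas on
`IsHardSphereEulerSolution σ T ρ u θ` (classical solutions on `[0, T) × 𝕋³`,
`Literature/MathematicalPhysics/KineticTheory/HardSphereEuler.lean`) that every continuation or
a-priori-bound argument uses, and which the tree did not yet have:

* `isHardSphereEulerSolution_of_nonpos` — for `T ≤ 0` the time interval `[0, T)` is empty and every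
  triple of fields is (vacuously) a solution;
* `isHardSphereEulerSolution_restrict` — a solution on `[0, T')` is a solution on `[0, T)` for every
  `T ≤ T'`: the one-sided time derivatives within `[0, T)` and within `[0, T')` agree at every
  `t ∈ [0, T)` because the two intervals coincide near `t` (`Ico_eventuallyEq_Ico`,
  Mathlib `derivWithin_congr_set`);
* `isHardSphereEulerSolution_of_forall_lt` — conversely, fields solving on `[0, T)` for every
  `T < T'` solve on `[0, T')` (every clause of the structure is local in time; joint smoothness is
  `ContDiffOn`, a within-set local property);
* `isHardSphereEulerSolution_iff_forall_lt` — the two combined;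
* `isHardSphereEulerSolution_congr` — fields agreeing slice-wise on `[0, T)` are solutions
  simultaneously (only the values on `[0, T) × 𝕋³` enter: Mathlib `derivWithin_congr`,
  `ContDiffOn.congr`, and the space derivatives only see the slice at time `t`);
* `isHardSphereEulerSolution_isSmooth_slice` — the slices `ρ t`, `u t`, `θ t` are smooth on
  `[0, T)` (smooth data at `t = 0` when `0 < T`),

together with the underlying lemmas on `Torus.timeDerivWithin` and `Torus.IsSmoothSpaceTimeOn`
for nested time sets. No uniqueness statement is made here (that is energy-method content).
-/

namespace Summit.AtomisticToContinuum.HydrodynamicLimit.Theorems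

open Set Filter Topology
open scoped ContDiff
open Literature.MathematicalPhysics.KineticTheory Literature.Analysis.FunctionSpaces

/-! ### Nested half-open time intervals -/

/-- For `t ∈ [0, T)` and `T ≤ T'` the intervals `[0, T)` and `[0, T')` agree near `t`
(both coincide with `[0, ∞)` on the neighbourhood `(-∞, T)` of `t`). [folklore] -/
theorem Ico_eventuallyEq_Ico {T T' t : ℝ} (ht : t ∈ Ico 0 T) (hT : T ≤ T') :
    (Ico 0 T : Set ℝ) =ᶠ[𝓝 t] Ico 0 T' := by
  refine Filter.eventuallyEq_set.2 ?_
  filter_upwards [Iio_mem_nhds ht.2] with τ hτ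
  exact ⟨fun h => ⟨h.1, h.2.trans_le hT⟩, fun h => ⟨h.1, hτ⟩⟩

/-- For `t ∈ [0, T)` the set `[0, T) × E` is a neighbourhood of `(t, y)` within `[0, T') × E`
for every `T'` (it contains the trace of the open set `(-∞, T) × E`). [folklore] -/
theorem Ico_prod_mem_nhdsWithin {E : Type*} [TopologicalSpace E] {T : ℝ} (T' : ℝ) {p : ℝ × E}
    (hp : p.1 ∈ Ico 0 T) :
    Ico 0 T ×ˢ (univ : Set E) ∈ 𝓝[Ico 0 T' ×ˢ univ] p := by
  refine mem_nhdsWithin_iff_exists_mem_nhds_inter.2 ⟨Iio T ×ˢ univ, ?_, ?_⟩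
  · exact prod_mem_nhds (Iio_mem_nhds hp.2) univ_mem
  · rintro q ⟨hq₁, hq₂⟩
    exact ⟨⟨hq₂.1.1, hq₁.1⟩, mem_univ _⟩

/-! ### `Torus.timeDerivWithin` and `Torus.IsSmoothSpaceTimeOn` on nested time sets -/

section TimeSets

variable {d : Type*} {F : Type*} [NormedAddCommGroup F] [NormedSpace ℝ F]

/-- The one-sided time derivatives within `[0, T)` and within `[0, T')`, `T ≤ T'`, agree at every
`t ∈ [0, T)` (Mathlib `derivWithin_congr_set` with `Ico_eventuallyEq_Ico`). [folklore] -/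
theorem timeDerivWithin_Ico_eq_of_le {T T' t : ℝ} (ht : t ∈ Ico 0 T) (hT : T ≤ T')
    (f : ℝ → UnitAddTorus d → F) (x : UnitAddTorus d) :
    Torus.timeDerivWithin (Ico 0 T) f t x = Torus.timeDerivWithin (Ico 0 T') f t x :=
  derivWithin_congr_set (Ico_eventuallyEq_Ico ht hT)

/-- The time derivative within `S` at a point of `S` only sees the values of the field on `S`
(Mathlib `derivWithin_congr`). [folklore] -/
theorem timeDerivWithin_congr {S : Set ℝ} {f g : ℝ → UnitAddTorus d → F}
    (h : ∀ τ ∈ S, f τ = g τ) {t : ℝ} (ht : t ∈ S) (x : UnitAddTorus d) :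
    Torus.timeDerivWithin S f t x = Torus.timeDerivWithin S g t x :=
  derivWithin_congr (fun τ hτ => congrFun (h τ hτ) x) (congrFun (h t ht) x)

variable [Fintype d]

/-- Joint space–time smoothness restricts to smaller time sets (Mathlib `ContDiffOn.mono`).
[folklore] -/
theorem isSmoothSpaceTimeOn_mono {S S' : Set ℝ} (hS : S ⊆ S') {f : ℝ → UnitAddTorus d → F}
    (h : Torus.IsSmoothSpaceTimeOn S' f) : Torus.IsSmoothSpaceTimeOn S f :=
  ContDiffOn.mono h (prod_mono hS Subset.rfl)

/-- Joint space–time smoothness on the empty time set is vacuous. [folklore] -/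
theorem isSmoothSpaceTimeOn_empty (f : ℝ → UnitAddTorus d → F) :
    Torus.IsSmoothSpaceTimeOn (∅ : Set ℝ) f := by
  unfold Torus.IsSmoothSpaceTimeOn
  rw [empty_prod]
  exact contDiffOn_empty

/-- Joint space–time smoothness on `S` only sees the values of the field on `S`
(Mathlib `ContDiffOn.congr`). [folklore] -/
theorem isSmoothSpaceTimeOn_congr {S : Set ℝ} {f g : ℝ → UnitAddTorus d → F}
    (h : ∀ τ ∈ S, f τ = g τ) (hg : Torus.IsSmoothSpaceTimeOn S g) :
    Torus.IsSmoothSpaceTimeOn S f :=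
  ContDiffOn.congr hg fun p hp => by
    show f p.1 (Torus.proj p.2) = g p.1 (Torus.proj p.2)
    rw [h p.1 hp.1]

/-- Joint space–time smoothness on `[0, T')` from joint smoothness on every `[0, T)`, `T < T'`
(`ContDiffOn` is local within the set: Mathlib `ContDiffWithinAt.mono_of_mem_nhdsWithin` with
`Ico_prod_mem_nhdsWithin`). [folklore] -/
theorem isSmoothSpaceTimeOn_Ico_of_forall_lt {T' : ℝ} {f : ℝ → UnitAddTorus d → F}
    (h : ∀ T < T', Torus.IsSmoothSpaceTimeOn (Ico 0 T) f) :
    Torus.IsSmoothSpaceTimeOn (Ico 0 T') f := by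
  intro p hp
  obtain ⟨T, hpT, hTT'⟩ := exists_between (mem_prod.1 hp).1.2
  have hp' : p.1 ∈ Ico 0 T := ⟨(mem_prod.1 hp).1.1, hpT⟩
  exact (h T hTT' p ⟨hp', mem_univ _⟩).mono_of_mem_nhdsWithin
    (Ico_prod_mem_nhdsWithin T' hp')

end TimeSets

/-! ### Classical hard-sphere–Euler solutions: degenerate interval, restriction, gluing,
congruence, smooth slices -/

/-- **Degenerate time interval.** For `T ≤ 0` the interval `[0, T)` is empty, so every triple of
fields is (vacuously) a classical hard-sphere–Euler solution on `[0, T)`. [folklore] -/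
theorem isHardSphereEulerSolution_of_nonpos {σ T : ℝ} {ρ θ : ℝ → T3 → ℝ} {u : ℝ → T3 → V3}
    (hT : T ≤ 0) : IsHardSphereEulerSolution σ T ρ u θ := by
  have hI : Ico (0 : ℝ) T = ∅ := Ico_eq_empty (not_lt.2 hT)
  refine ⟨?_, ?_, ?_, ?_, ?_, ?_, ?_, ?_⟩
  · rw [hI]; exact isSmoothSpaceTimeOn_empty ρ
  · rw [hI]; exact isSmoothSpaceTimeOn_empty u
  · rw [hI]; exact isSmoothSpaceTimeOn_empty θ
  all_goals intro t ht; rw [hI] at ht; exact ht.elim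

/-- **Restriction.** A classical hard-sphere–Euler solution on `[0, T')` is a classical solution on
`[0, T)` for every `T ≤ T'`: smoothness and the pointwise clauses restrict, and the one-sided time
derivatives within `[0, T)` and `[0, T')` agree on `[0, T)` (`timeDerivWithin_Ico_eq_of_le`).
[folklore] -/
theorem isHardSphereEulerSolution_restrict :
    ∀ {σ T T' : ℝ} {ρ θ : ℝ → T3 → ℝ} {u : ℝ → T3 → V3},
      IsHardSphereEulerSolution σ T' ρ u θ → T ≤ T' → IsHardSphereEulerSolution σ T ρ u θ := by
  intro σ T T' ρ θ u h hT
  have hsub : Ico (0 : ℝ) T ⊆ Ico 0 T' := Ico_subset_Ico_right hT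
  refine ⟨isSmoothSpaceTimeOn_mono hsub h.smooth_density,
    isSmoothSpaceTimeOn_mono hsub h.smooth_velocity,
    isSmoothSpaceTimeOn_mono hsub h.smooth_temperature,
    fun t ht x => h.density_pos t (hsub ht) x, fun t ht x => h.temperature_pos t (hsub ht) x,
    fun t ht x => ?_, fun t ht x => ?_, fun t ht x => ?_⟩
  · rw [timeDerivWithin_Ico_eq_of_le ht hT]
    exact h.mass t (hsub ht) x
  · rw [timeDerivWithin_Ico_eq_of_le ht hT]
    exact h.momentum t (hsub ht) x
  · rw [timeDerivWithin_Ico_eq_of_le ht hT]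
    exact h.energy t (hsub ht) x

/-- **Gluing in time.** Fields that are classical hard-sphere–Euler solutions on `[0, T)` for every
`T < T'` are a classical solution on `[0, T')`: each clause at `t ∈ [0, T')` is read off from the
solution property on `[0, T)` for any `T ∈ (t, T')` (`timeDerivWithin_Ico_eq_of_le`,
`isSmoothSpaceTimeOn_Ico_of_forall_lt`). [folklore] -/
theorem isHardSphereEulerSolution_of_forall_lt {σ T' : ℝ} {ρ θ : ℝ → T3 → ℝ} {u : ℝ → T3 → V3}
    (h : ∀ T < T', IsHardSphereEulerSolution σ T ρ u θ) :
    IsHardSphereEulerSolution σ T' ρ u θ := by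
  have key : ∀ t ∈ Ico (0 : ℝ) T', ∃ T, t ∈ Ico 0 T ∧ T < T' := fun t ht => by
    obtain ⟨T, htT, hTT'⟩ := exists_between ht.2
    exact ⟨T, ⟨ht.1, htT⟩, hTT'⟩
  refine ⟨isSmoothSpaceTimeOn_Ico_of_forall_lt fun T hT => (h T hT).smooth_density,
    isSmoothSpaceTimeOn_Ico_of_forall_lt fun T hT => (h T hT).smooth_velocity,
    isSmoothSpaceTimeOn_Ico_of_forall_lt fun T hT => (h T hT).smooth_temperature,
    fun t ht x => ?_, fun t ht x => ?_, fun t ht x => ?_, fun t ht x => ?_, fun t ht x => ?_⟩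
  · obtain ⟨T, htT, hTT'⟩ := key t ht
    exact (h T hTT').density_pos t htT x
  · obtain ⟨T, htT, hTT'⟩ := key t ht
    exact (h T hTT').temperature_pos t htT x
  · obtain ⟨T, htT, hTT'⟩ := key t ht
    rw [← timeDerivWithin_Ico_eq_of_le htT hTT'.le]
    exact (h T hTT').mass t htT x
  · obtain ⟨T, htT, hTT'⟩ := key t ht
    rw [← timeDerivWithin_Ico_eq_of_le htT hTT'.le]
    exact (h T hTT').momentum t htT x
  · obtain ⟨T, htT, hTT'⟩ := key t ht
    rw [← timeDerivWithin_Ico_eq_of_le htT hTT'.le]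
    exact (h T hTT').energy t htT x

/-- A triple of fields is a classical hard-sphere–Euler solution on `[0, T')` iff it is one on
`[0, T)` for every `T < T'` (`isHardSphereEulerSolution_restrict` and
`isHardSphereEulerSolution_of_forall_lt`). [folklore] -/
theorem isHardSphereEulerSolution_iff_forall_lt {σ T' : ℝ} {ρ θ : ℝ → T3 → ℝ} {u : ℝ → T3 → V3} :
    IsHardSphereEulerSolution σ T' ρ u θ ↔ ∀ T < T', IsHardSphereEulerSolution σ T ρ u θ :=
  ⟨fun h _ hT => isHardSphereEulerSolution_restrict h hT.le, isHardSphereEulerSolution_of_forall_lt⟩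

/-- **Congruence.** Only the values on `[0, T) × 𝕋³` enter: if `(ρ', u', θ')` agree slice-wise
with a classical hard-sphere–Euler solution `(ρ, u, θ)` at every `t ∈ [0, T)`, then `(ρ', u', θ')`
is a classical solution on `[0, T)` as well (joint smoothness by `ContDiffOn.congr`, the time
derivatives within `[0, T)` by `derivWithin_congr`, and the space derivatives at time `t` only
see the slice at time `t`). [folklore] -/
theorem isHardSphereEulerSolution_congr {σ T : ℝ} {ρ ρ' θ θ' : ℝ → T3 → ℝ} {u u' : ℝ → T3 → V3}
    (h : IsHardSphereEulerSolution σ T ρ u θ) (hρ : ∀ t ∈ Ico 0 T, ρ' t = ρ t)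
    (hu : ∀ t ∈ Ico 0 T, u' t = u t) (hθ : ∀ t ∈ Ico 0 T, θ' t = θ t) :
    IsHardSphereEulerSolution σ T ρ' u' θ' := by
  have hρu : ∀ t ∈ Ico 0 T, (fun y => ρ' t y • u' t y) = fun y => ρ t y • u t y := fun t ht => by
    rw [hρ t ht, hu t ht]
  have hE : ∀ t ∈ Ico 0 T, (fun y => totalEnergyDensity (ρ' t y) (u' t y) (θ' t y)) =
      fun y => totalEnergyDensity (ρ t y) (u t y) (θ t y) := fun t ht => by
    rw [hρ t ht, hu t ht, hθ t ht]
  refine ⟨isSmoothSpaceTimeOn_congr hρ h.smooth_density,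
    isSmoothSpaceTimeOn_congr hu h.smooth_velocity,
    isSmoothSpaceTimeOn_congr hθ h.smooth_temperature,
    fun t ht x => ?_, fun t ht x => ?_, fun t ht x => ?_, fun t ht x => ?_, fun t ht x => ?_⟩
  · rw [hρ t ht]
    exact h.density_pos t ht x
  · rw [hθ t ht]
    exact h.temperature_pos t ht x
  · rw [timeDerivWithin_congr hρ ht, hρ t ht, hu t ht]
    exact h.mass t ht x
  · rw [timeDerivWithin_congr hρu ht, hρ t ht, hu t ht, hθ t ht]
    exact h.momentum t ht x
  · rw [timeDerivWithin_congr hE ht, hρ t ht, hu t ht, hθ t ht]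
    exact h.energy t ht x

/-- **Smooth time slices.** The fields of a classical hard-sphere–Euler solution on `[0, T)` have
smooth slices `ρ t`, `u t`, `θ t` at every `t ∈ [0, T)` (in particular smooth data at `t = 0` when
`0 < T`) (`Torus.IsSmoothSpaceTimeOn.isSmooth_slice`). [folklore] -/
theorem isHardSphereEulerSolution_isSmooth_slice {σ T : ℝ} {ρ θ : ℝ → T3 → ℝ} {u : ℝ → T3 → V3}
    (h : IsHardSphereEulerSolution σ T ρ u θ) {t : ℝ} (ht : t ∈ Ico 0 T) :
    Torus.IsSmooth (ρ t) ∧ Torus.IsSmooth (u t) ∧ Torus.IsSmooth (θ t) :=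
  ⟨h.smooth_density.isSmooth_slice ht, h.smooth_velocity.isSmooth_slice ht,
    h.smooth_temperature.isSmooth_slice ht⟩

end Summit.AtomisticToContinuum.HydrodynamicLimit.Theorems
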